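import Summits.QuantumFields.BalabanUV.Beta.GAN24.CoProjBmDivFree
import Summits.QuantumFields.BalabanUV.Beta.D1BFx.GhostStencilRooted
import Summits.QuantumFields.BalabanUV.Beta.D1BFx.TowerEquationForms

/-!
# `BalabanUV.Beta.D1BFx.GhostCurrentDressing` — road «BF-x» for binder row D1, junction (J3) ∕ Q-GH-W′, brick «GH-DRESS FORMULA»:
# **THE BLOCK-MEAN AXIAL DRESSING OF THE GHOST CURRENT, ENTRYWISE** — for every kernel entry `(x, z)` and every bond `(α, q)`,
# `(Πᵀ_bm ghCur(·;x,z))(α,q) = ghCur(α,q;x,z) − nn(x,z)·(φ_{α,q}(x) − φ_{α,q}(z))` with `φ_{α,q} = bmGaugeAt ρ δ_{(α,q)} n` the block-local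
# gauge potential of the bond indicator and `nn(x,z) = Σ_β ([x = z + e_β] + [z = x + e_β]) ∈ {0,1}` the nearest-neighbour indicator; on SAME-BLOCK
# entries `φ(x) − φ(z) = −n⁴·qAntiAt ρ n α q x z`, so on same-block NEAREST-NEIGHBOUR entries the dressed current IS the stencil `SghAt ρ n 1 n⁴`.

HONEST DEPENDENCY (page 1, mandatory): continuum YM on T⁴ ⇐ BetaPertH ∧ nine spine estimates (0/9 proved); BetaPertH ⇐ (D1) ∧ (D4) ∧
CAP+tail; G-an2-4 gates asym, D1 and NE2/3/4.  HONEST FRAMING: discharging `BetaPertH` makes Bałaban's UV stability UNCONDITIONAL — NOT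
the continuum limit and NOT the Clay problem.  THIS FILE DISCHARGES NOTHING of row D1: it is [folklore] finite bookkeeping over the tree's
definitions (`AxialDressingRooted.coProjBmAt`, `AxialProjectorBlockMean.bmGaugeAt`, `GhostStencil.ghCur`, `GhostStencilRooted.qAntiAt ∕ SghAt`)
and leaf-02 g51's summation-by-parts identity `GAN24.CoProjBmDivFree.coProjBmAt_eq_self_sub_tsum_div`, BY NAME.  0 `def`, 0 cited facts,
0 `def … : Prop`, 0 sorry; nothing of Bałaban's asserted; (J3) of `RoadEndBFxJunctionsS` ∕ `RoadEndBFxRoadS` ∕ `RoadEndBFxRoadGhostFreeS` stays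
DISPLAYED; 0 root-level binders discharged; (K) NOT closed; NOT D1, NOT BetaPertH, NOT continuum, NOT Clay.
ABSOLUTE RULE (cell charter, verbatim): «No internally-minted statement may enter as a cited fact. Every hypothesis is either
kernel-proved in this package or a verbatim quotation of a PUBLISHED theorem with page reference. The manuscript(s) under audit are NOT
citable for their own disputed steps — they are the thing under adjudication; programme-internal (2001/route/tribunal) claims are never
citable.»

WHY (unit `b2b-balaban-beta-d1-p2`, gen 19; journal LOCATED READING L-g19-1 + ERRATUM E-2 ∕ ADDENDUM A-1): the road's ghost main word is
`TOfGh n a (n² • Πᵀ_bm ghCur) (…)` (`PackedGhostWordEnd.ghostWord_G₀_eq_TOfGh_coProj`), the END's is `TOfGh n a (SghAt ρ n cK cQ) (…)`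
(`GhostKernelComplete.PghQ`); this file says EXACTLY what the dressed current is in the END's stencil letters, entry by entry: the dressing
correction is a PURE-GAUGE term supported on nearest-neighbour entries (the commutator of the free hopping with `φ_{α,q}`), which on same-block
nearest-neighbour entries coincides with `n⁴•qAntiAt` and elsewhere does not (`qAntiAt`, the first jet of `Q′(U)*Q′(U)`, is supported on ALL
same-block entries).  What the junction (J3) does with this is the row owner's ruling (an2 g40's R-D1-g40-1: the dressing correction is
pure gauge, the END's `cQ•qAntiAt` is the `Q′(U)*Q′(U)` jet the road's word must carry — repair road-side); nothing about it is asserted here.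

## What (`ρ = toSite r`, `r ∈ box 4 N`, `1 ≤ N`; `φ := bmGaugeAt ρ (fun κ w ↦ (bondInd α q κ w : ℝ)) N`; `blk = AveragingContours.blk`)
* §1 `sum_ghCur_sub_eq` — the lattice divergence of the current: `Σ_β (ghCur β (p − e_β) x z − ghCur β p x z) = ([p = x] − [p = z])·nn(x,z)`;
  `nn_add_unitVec ∕ nn_add_unitVec'` — `nn(z + e_β, z) = nn(x, x + e_β) = 1`.
* §2 `bondInd_real_eq_bondForm`, `treeGaugeAt_bondInd_eq_gammaCoeff` (`λ_{(α,q)}(p) = gammaCoeff α q (N•blk p + ρ) p`, definitions);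
  `bmGaugeAt_bondInd_sub_of_blk_eq` (same block: `φ(x) − φ(z) = [blk q = blk x]·(γ(root,x) − γ(root,z))`, block means cancel, `φ` block-supported);
  `pow_mul_qAntiAt_of_blk_eq` (`N⁴·qAntiAt ρ N α q x z = [blk q = blk x]·(γ(root,z) − γ(root,x))` on same-block entries).
* §3 **`coProjBmAt_ghCur_eq`** (the general entrywise formula above, all `x z`); `coProjBmAt_ghCur_eq_zero_of_not_nn` (off nearest-neighbour
  entries the current is the zero form, so is its dressing — any root); **`coProjBmAt_ghCur_of_blk_eq`** (same block:
  `= ghCur α q x z + nn(x,z)·(N⁴·qAntiAt ρ N α q x z)`); **`coProjBmAt_ghCur_nn ∕ coProjBmAt_ghCur_nn'`** (same-block nearest neighbours: the dressed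
  current column `(fun κ u ↦ (Πᵀ_bm ghCur(·; z+e_β, z))(κ,u))` IS `fun κ u ↦ SghAt ρ N 1 N⁴ κ u (z+e_β) z`, and the mirrored entry).
-/

noncomputable section

open Finset
open scoped BigOperators
open Literature.MathematicalPhysics.QuantumFieldTheory
open Literature.MathematicalPhysics.QuantumFieldTheory.Balaban1983to89
open Literature.MathematicalPhysics.QuantumFieldTheory.Balaban1983to89.Beta
open ExpKernelCalculus (Site MKer)
open AffineAveraging (Form0 Form1 box toSite unitVec unitVec_apply)
open AveragingContours (blk axial)
open AveragingContoursRooted (treeGaugeAt)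
open Summit.QuantumFields.BalabanUV.Beta.AxialProjectorBlockMean (blockMeanAt bmGaugeAt)
open Summit.QuantumFields.BalabanUV.Beta.AxialDressingRooted (bondInd bondInd_apply pmBm cube coProjBmAt coProjBmAt_apply)
open Summit.QuantumFields.BalabanUV.Beta.GAN24.CoProjBmDivFree (coProjBmAt_eq_self_sub_tsum_div bmGaugeAt_bondInd_eq_zero_of_blk_ne)
open Summit.QuantumFields.BalabanUV.Beta.D1BFx.GhostStencil (bondForm gammaCoeff ghCur ghCur_apply unitVec_ne_zero)
open Summit.QuantumFields.BalabanUV.Beta.D1BFx.GhostStencilRooted (qJetAt qAntiAt qAntiAt_apply SghAt SghAt_apply)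
open Summit.QuantumFields.BalabanUV.Beta.D1BFx.TowerEquationForms (blk_pred_eq_blk)

namespace Summit.QuantumFields.BalabanUV.Beta.D1BFx.GhostCurrentDressing

/-! ## §1 The lattice divergence of the ghost current; the nearest-neighbour indicator -/

/-- [folklore] No site is its own `e_β`-translate. -/
theorem ne_add_unitVec (p : Site 4) (β : Fin 4) : p ≠ p + unitVec β := by
  intro h
  have h' := congrFun h β
  simp only [Pi.add_apply, unitVec_apply, if_true] at h'
  omega

/-- [folklore] No site is its own `(−e_β)`-translate. -/
theorem ne_sub_unitVec (p : Site 4) (β : Fin 4) : p ≠ p - unitVec β := by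
  intro h
  have h' := congrFun h β
  simp only [Pi.sub_apply, unitVec_apply, if_true] at h'
  omega

/-- [folklore] `z = p − e ↔ p = z + e`. -/
theorem eq_sub_iff_eq_add (z p e : Site 4) : z = p - e ↔ p = z + e := by
  rw [eq_sub_iff_add_eq, eq_comm]

/-- [folklore] **THE LATTICE DIVERGENCE OF THE GHOST CURRENT**: for the one-form `(β, p) ↦ ghCur β p x z` (a kernel entry `(x, z)` read as a
function of the bond), `Σ_β (ghCur β (p − e_β) x z − ghCur β p x z) = ([p = x] − [p = z]) · nn(x, z)`, `nn(x,z) = Σ_β ([x = z+e_β] + [z = x+e_β])`. -/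
theorem sum_ghCur_sub_eq (x z : Site 4) (a b : Unit) (p : Site 4) :
    ∑ β : Fin 4, (ghCur β (p - unitVec β) x z a b - ghCur β p x z a b)
      = ((if p = x then (1 : ℝ) else 0) - (if p = z then (1 : ℝ) else 0))
          * ∑ β : Fin 4, ((if x = z + unitVec β then (1 : ℝ) else 0) + (if z = x + unitVec β then (1 : ℝ) else 0)) := by
  rw [Finset.mul_sum]
  refine Finset.sum_congr rfl fun β _ => ?_
  rw [ghCur_apply, ghCur_apply]
  simp only [sub_add_cancel]
  have h1 := ne_add_unitVec p β
  have h2 := ne_sub_unitVec p β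
  by_cases hx : p = x
  · subst hx
    by_cases hz : p = z
    · subst hz
      simp only [h1, h2, and_false, false_and, if_false, if_true, sub_self, zero_mul]
    · have hz' : ¬z = p := fun h => hz h.symm
      simp only [h1, h2, hz, hz', true_and, and_false, if_false, if_true, eq_sub_iff_eq_add]
      ring
  · have hx' : ¬x = p := fun h => hx h.symm
    by_cases hz : p = z
    · subst hz
      simp only [h1, h2, hx, hx', and_true, and_false, if_false, if_true, eq_sub_iff_eq_add]
      ring
    · have hz' : ¬z = p := fun h => hz h.symm
      simp only [hx, hx', hz, hz', false_and, and_false, if_false, sub_self, zero_mul]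

/-- [folklore] The nearest-neighbour indicator of `(z + e_β, z)` is `1`. -/
theorem nn_add_unitVec (β : Fin 4) (z : Site 4) :
    ∑ β' : Fin 4, ((if z + unitVec β = z + unitVec β' then (1 : ℝ) else 0) + (if z = z + unitVec β + unitVec β' then (1 : ℝ) else 0)) = 1 := by
  have h1 : ∀ β' : Fin 4, (z + unitVec β = z + unitVec β') ↔ β = β' := by
    intro β'
    constructor
    · intro h
      have h' := congrArg (fun w : Site 4 => (w - z) β) h
      simp only [add_sub_cancel_left, unitVec_apply, if_true] at h'
      by_contra hne
      rw [if_neg hne] at h'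
      exact one_ne_zero h'
    · rintro rfl; rfl
  have h2 : ∀ β' : Fin 4, ¬(z = z + unitVec β + unitVec β') := by
    intro β' h
    have h' := congrArg (fun w : Site 4 => (w - z) β) h
    simp only [sub_self, Pi.zero_apply, add_assoc, add_sub_cancel_left, Pi.add_apply, unitVec_apply, if_true] at h'
    by_cases hb : β = β'
    · rw [if_pos hb] at h'; norm_num at h'
    · rw [if_neg hb] at h'; norm_num at h'
  simp only [h1, h2, if_false, add_zero, Finset.sum_ite_eq, Finset.mem_univ, if_true]

/-- [folklore] The nearest-neighbour indicator of `(x, x + e_β)` is `1`. -/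
theorem nn_add_unitVec' (β : Fin 4) (x : Site 4) :
    ∑ β' : Fin 4, ((if x = x + unitVec β + unitVec β' then (1 : ℝ) else 0) + (if x + unitVec β = x + unitVec β' then (1 : ℝ) else 0)) = 1 := by
  exact (Finset.sum_congr rfl fun β' _ => add_comm _ _).trans (nn_add_unitVec β x)

/-! ## §2 The gauge potential of a bond indicator in the ghost-stencil letters -/

/-- [folklore] The real cast of an2's bond indicator IS T6's bond one-form: `(bondInd α q : ℝ) = bondForm α q`. -/
theorem bondInd_real_eq_bondForm (α : Fin 4) (q : Site 4) : (fun κ w => (bondInd α q κ w : ℝ)) = bondForm α q := by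
  funext κ w
  rw [bondInd_apply]
  by_cases h : κ = α ∧ w = q
  · simp only [h, and_self, if_true, Int.cast_one, bondForm]
  · simp only [h, if_false, Int.cast_zero, bondForm]

/-- [folklore] **THE ROOTED TREE GAUGE OF A BOND INDICATOR IS THE SIGNED MULTIPLICITY `γ`** (definitions `treeGaugeAt` :345 ∕ `gammaCoeff` :172):
`treeGaugeAt ρ δ_{(α,q)} N p = gammaCoeff α q (N • blk N p + ρ) p`. -/
theorem treeGaugeAt_bondInd_eq_gammaCoeff (ρ : Site 4) (α : Fin 4) (q : Site 4) (N : ℕ) (p : Site 4) :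
    treeGaugeAt ρ (fun κ w => (bondInd α q κ w : ℝ)) N p = gammaCoeff α q ((N : ℤ) • blk N p + ρ) p := by
  rw [bondInd_real_eq_bondForm]
  rfl

/-- [folklore] The block mean of any function takes the same value at two sites of one block. -/
theorem blockMeanAt_eq_of_blk_eq (N : ℕ) (f : Form0 4 ℝ) {x z : Site 4} (h : blk N x = blk N z) : blockMeanAt N f x = blockMeanAt N f z := by
  simp only [blockMeanAt, h]

/-- [folklore] **SAME BLOCK: THE GAUGE POTENTIALS DIFFER BY THE `γ`-DIFFERENCE** (block means cancel; off the bond's block both vanish):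
`φ_{α,q}(x) − φ_{α,q}(z) = [blk q = blk x]·(γ(α,q; N•blk x + ρ, x) − γ(α,q; N•blk x + ρ, z))` for `blk x = blk z`. -/
theorem bmGaugeAt_bondInd_sub_of_blk_eq {N : ℕ} (hN : 1 ≤ N) {r : Fin 4 → ℕ} (hr : r ∈ box (3 + 1) N) (α : Fin 4) (q : Site 4) {x z : Site 4}
    (h : blk N x = blk N z) :
    bmGaugeAt (toSite r) (fun κ w => (bondInd α q κ w : ℝ)) N x - bmGaugeAt (toSite r) (fun κ w => (bondInd α q κ w : ℝ)) N z
      = if blk N q = blk N x then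
          gammaCoeff α q ((N : ℤ) • blk N x + toSite r) x - gammaCoeff α q ((N : ℤ) • blk N x + toSite r) z else 0 := by
  split_ifs with hq
  · simp only [bmGaugeAt, Pi.sub_apply]
    rw [blockMeanAt_eq_of_blk_eq N _ h, treeGaugeAt_bondInd_eq_gammaCoeff, treeGaugeAt_bondInd_eq_gammaCoeff, ← h]
    ring
  · have hx : blk N x ≠ blk N q := fun e => hq e.symm
    have hz : blk N z ≠ blk N q := fun e => hq (e.symm.trans h.symm)
    rw [bmGaugeAt_bondInd_eq_zero_of_blk_ne hN hr α q hx, bmGaugeAt_bondInd_eq_zero_of_blk_ne hN hr α q hz, sub_zero]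

/-- [folklore] **SAME BLOCK: `N⁴·qAntiAt` IS THE `γ`-DIFFERENCE** (definitions `qJetAt` ∕ `qAntiAt`; the pv23 block label `blk (N−1)` of T6 is
`AveragingContours.blk N`, `TowerEquationForms.blk_pred_eq_blk`): `N⁴·qAntiAt ρ N α q x z = [blk q = blk x]·(γ(root,z) − γ(root,x))` for `blk x = blk z`. -/
theorem pow_mul_qAntiAt_of_blk_eq {N : ℕ} (hN : 1 ≤ N) (ρ : Site 4) (α : Fin 4) (q : Site 4) {x z : Site 4} (h : blk N x = blk N z) (a b : Unit) :
    ((N : ℝ) ^ 4) * qAntiAt ρ N α q x z a b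
      = if blk N q = blk N x then gammaCoeff α q ((N : ℤ) • blk N x + ρ) z - gammaCoeff α q ((N : ℤ) • blk N x + ρ) x else 0 := by
  haveI : NeZero N := ⟨by omega⟩
  have hN0 : ((N : ℝ) ^ 4) ≠ 0 := by positivity
  rw [qAntiAt_apply]
  simp only [qJetAt, blk_pred_eq_blk N]
  rw [← h]
  simp only [true_and]
  split_ifs with hq
  · rw [mul_sub, ← mul_assoc, ← mul_assoc, mul_inv_cancel₀ hN0, one_mul, one_mul]
  · rw [sub_zero, mul_zero]

/-! ## §3 The dressed ghost current, entrywise -/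

/-- [folklore] **THE BLOCK-MEAN AXIAL DRESSING OF THE GHOST CURRENT, ENTRYWISE** (in-block root, `1 ≤ N`, ALL entries `(x, z)`):
`(Πᵀ_bm ghCur(·;x,z))(α,q) = ghCur(α,q;x,z) − nn(x,z)·(φ_{α,q}(x) − φ_{α,q}(z))`, `φ_{α,q} = bmGaugeAt ρ δ_{(α,q)} N` — the dressing correction
is the commutator of the free nearest-neighbour hopping with the block-local gauge potential (a PURE-GAUGE term), from leaf-02 g51's
`coProjBmAt_eq_self_sub_tsum_div` and the divergence §1. -/
theorem coProjBmAt_ghCur_eq {N : ℕ} (hN : 1 ≤ N) {r : Fin 4 → ℕ} (hr : r ∈ box (3 + 1) N) (x z : Site 4) (a b : Unit) (α : Fin 4) (q : Site 4) :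
    coProjBmAt (toSite r) N (fun κ' u' => ghCur κ' u' x z a b) α q
      = ghCur α q x z a b
        - (∑ β : Fin 4, ((if x = z + unitVec β then (1 : ℝ) else 0) + (if z = x + unitVec β then (1 : ℝ) else 0)))
          * (bmGaugeAt (toSite r) (fun κ w => (bondInd α q κ w : ℝ)) N x - bmGaugeAt (toSite r) (fun κ w => (bondInd α q κ w : ℝ)) N z) := by
  rw [coProjBmAt_eq_self_sub_tsum_div hN hr]
  set φ : Form0 4 ℝ := bmGaugeAt (toSite r) (fun κ w => (bondInd α q κ w : ℝ)) N with hφ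
  set nn : ℝ := ∑ β : Fin 4, ((if x = z + unitVec β then (1 : ℝ) else 0) + (if z = x + unitVec β then (1 : ℝ) else 0)) with hnn
  have e : ∀ p : Site 4, φ p * ∑ β : Fin 4, (ghCur β (p - unitVec β) x z a b - ghCur β p x z a b)
      = (if p = x then φ x * nn else 0) - (if p = z then φ z * nn else 0) := by
    intro p
    rw [sum_ghCur_sub_eq, ← hnn]
    by_cases hx : p = x
    · by_cases hz : p = z
      · rw [if_pos hx, if_pos hz, if_pos hx, if_pos hz, ← hx, ← hz]; ring
      · rw [if_pos hx, if_neg hz, if_pos hx, if_neg hz, ← hx]; ring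
    · by_cases hz : p = z
      · rw [if_neg hx, if_pos hz, if_neg hx, if_pos hz, ← hz]; ring
      · rw [if_neg hx, if_neg hz, if_neg hx, if_neg hz]; ring
  rw [tsum_congr e, (hasSum_ite_eq x (φ x * nn)).summable.tsum_sub (hasSum_ite_eq z (φ z * nn)).summable, tsum_ite_eq, tsum_ite_eq]
  ring

/-- [folklore] Off nearest-neighbour entries the current is the zero form, so its dressing vanishes too. -/
theorem coProjBmAt_ghCur_eq_zero_of_not_nn (ρ : Site 4) (N : ℕ) {x z : Site 4} (h : ∀ β : Fin 4, x ≠ z + unitVec β ∧ z ≠ x + unitVec β)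
    (a b : Unit) (α : Fin 4) (q : Site 4) : coProjBmAt ρ N (fun κ' u' => ghCur κ' u' x z a b) α q = 0 := by
  have h0 : (fun κ' u' => ghCur κ' u' x z a b) = fun _ _ => (0 : ℝ) := by
    funext κ' u'
    rw [ghCur_apply, if_neg, if_neg, sub_zero]
    · rintro ⟨hx, hz⟩
      exact (h κ').2 (by rw [hz, hx])
    · rintro ⟨hx, hz⟩
      exact (h κ').1 (by rw [hx, hz])
  rw [h0, coProjBmAt_apply]
  simp only [mul_zero, Finset.sum_const_zero]

/-- [folklore] **SAME-BLOCK ENTRIES: THE DRESSED CURRENT IN THE END's STENCIL LETTERS** —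
`(Πᵀ_bm ghCur(·;x,z))(α,q) = ghCur(α,q;x,z) + nn(x,z)·(N⁴·qAntiAt ρ N α q x z)` for `blk x = blk z`. -/
theorem coProjBmAt_ghCur_of_blk_eq {N : ℕ} (hN : 1 ≤ N) {r : Fin 4 → ℕ} (hr : r ∈ box (3 + 1) N) {x z : Site 4} (h : blk N x = blk N z)
    (a b : Unit) (α : Fin 4) (q : Site 4) :
    coProjBmAt (toSite r) N (fun κ' u' => ghCur κ' u' x z a b) α q
      = ghCur α q x z a b
        + (∑ β : Fin 4, ((if x = z + unitVec β then (1 : ℝ) else 0) + (if z = x + unitVec β then (1 : ℝ) else 0)))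
          * (((N : ℝ) ^ 4) * qAntiAt (toSite r) N α q x z a b) := by
  rw [coProjBmAt_ghCur_eq hN hr, bmGaugeAt_bondInd_sub_of_blk_eq hN hr α q h, pow_mul_qAntiAt_of_blk_eq hN (toSite r) α q h]
  split_ifs <;> ring

/-- [folklore] **SAME-BLOCK NEAREST NEIGHBOURS: THE DRESSED CURRENT COLUMN IS `SghAt ρ N 1 N⁴`** (entry `(z + e_β, z)`):
`(fun κ u ↦ (Πᵀ_bm ghCur(·; z+e_β, z))(κ,u)) = fun κ u ↦ SghAt ρ N 1 N⁴ κ u (z+e_β) z`. -/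
theorem coProjBmAt_ghCur_nn {N : ℕ} (hN : 1 ≤ N) {r : Fin 4 → ℕ} (hr : r ∈ box (3 + 1) N) (β : Fin 4) (z : Site 4)
    (h : blk N (z + unitVec β) = blk N z) (a b : Unit) :
    (fun κ u => coProjBmAt (toSite r) N (fun κ' u' => ghCur κ' u' (z + unitVec β) z a b) κ u)
      = fun κ u => SghAt (toSite r) N 1 ((N : ℝ) ^ 4) κ u (z + unitVec β) z a b := by
  funext κ u
  rw [coProjBmAt_ghCur_of_blk_eq hN hr h, nn_add_unitVec, SghAt_apply]
  ring

/-- [folklore] **SAME-BLOCK NEAREST NEIGHBOURS, MIRRORED ENTRY `(x, x + e_β)`**: `(fun κ u ↦ (Πᵀ_bm ghCur(·; x, x+e_β))(κ,u)) = fun κ u ↦ SghAt ρ N 1 N⁴ κ u x (x+e_β)`. -/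
theorem coProjBmAt_ghCur_nn' {N : ℕ} (hN : 1 ≤ N) {r : Fin 4 → ℕ} (hr : r ∈ box (3 + 1) N) (β : Fin 4) (x : Site 4)
    (h : blk N x = blk N (x + unitVec β)) (a b : Unit) :
    (fun κ u => coProjBmAt (toSite r) N (fun κ' u' => ghCur κ' u' x (x + unitVec β) a b) κ u)
      = fun κ u => SghAt (toSite r) N 1 ((N : ℝ) ^ 4) κ u x (x + unitVec β) a b := by
  funext κ u
  rw [coProjBmAt_ghCur_of_blk_eq hN hr h, nn_add_unitVec', SghAt_apply]
  ring

end Summit.QuantumFields.BalabanUV.Beta.D1BFx.GhostCurrentDressing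

end
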